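import Summits.Ventures.YMGap.RobustBall.LoopActivity
import Literature.MathematicalPhysics.QuantumLattice.WilsonLoopsProofs
import Literature.MathematicalPhysics.QuantumFieldTheory.LatticeGaugeAsymptoticsCornerEdges
import HarnessLib

/-!
# Venture YMGap, track ROBUST-BALL (tier 2) — Wilson loop observables on `ℤ^d` as action terms:
# gauge invariance, one-link Lipschitz bound by dart multiplicity, the loop term `c · Re tr U_γ / N`

HONEST FRAMING. WHAT THIS IS: a venture file (cell `pub-ymgap`, track Y2 ROBUST-BALL, seat rb-p1), the TERM
LAYER of the loop-action members of the tier-2 ball `MemBallZdS` (`LoopActionMember.lean`): for a closed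
lattice walk `γ` on `ℤ^d` (tree `zdGraph d`, `walkHolonomy`, `wilsonLoopObs`, `walkEdges`) and a coupling `c`,
the action term `loopTerm N c γ U = c · Re tr(U_γ) / N`. We prove
* GAUGE COVARIANCE of holonomies on `ℤ^d` (not in the tree before): `hol_γ(U^g) = g(x) hol_γ(U) g(y)⁻¹`
  along any walk from `x` to `y` (`walkHolonomy_gaugeTransformZd`), hence gauge invariance of every Wilson
  loop observable of a class function (`isZdGaugeInvariant_wilsonLoopObs`) and of `loopTerm`;
* the ONE-LINK FROBENIUS–LIPSCHITZ BOUND: if `U = V` off the link `y` then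
  `‖hol_γ U − hol_γ V‖_F ≤ mult_γ(y) · ‖U_y − V_y‖_F`, where `dartMult γ y` is the number of darts of `γ` over
  `y` (telescoping of unitary products), so `|loopTerm U − loopTerm V| ≤ |c| mult_γ(y)/√N · ‖U_y − V_y‖_F`;
* bookkeeping: `∑_{y ∈ walkEdges γ} mult_γ(y) = |γ|`, `|loopTerm| ≤ |c|`, continuity, dependence on
  `walkEdges γ` only, oscillation witness `2|c|`, value `c` at `U ≡ 1`.
WHAT IT IS NOT: no measure, no estimate on a Gibbs state, no number; nothing about the continuum limit or the
Clay problem.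

References: E. Seiler, LNP 159 (1982), Ch. 1 (gauge transformations, Wilson loops); the Frobenius telescoping is
that of `LoopActivity.lean` (this track, torus) transported to `ℤ^d`. [folklore]
-/

noncomputable section

open MeasureTheory Filter Function Topology Real SimpleGraph
open Literature.Probability.LatticeModels
open Literature.Probability.LatticeModels.DobrushinMetric
open Literature.MathematicalPhysics.QuantumLattice
open Literature.MathematicalPhysics.QuantumFieldTheory hiding ZdEdge Site

namespace Summit.Ventures.YMGap.RobustBall

variable {d : ℕ}

/-! ### Gauge covariance of holonomies on `ℤ^d` -/

section Gauge

variable {G : Type*} [Group G]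

/-- A dart cannot be positively oriented in both directions: `y = x + e_i` and `x = y + e_i` are
incompatible in `ℤ^d`. -/
theorem not_snd_eq_and_fst_eq (x y : Site d) (i : Fin d) (h1 : y = x + Pi.single i 1) (h2 : x = y + Pi.single i 1) :
    False := by
  have h := congrFun h2 i
  rw [h1] at h
  simp only [Pi.add_apply, Pi.single_eq_same] at h
  omega

/-- **Gauge covariance of a dart holonomy**: `hol_a(U^g) = g(a.fst) hol_a(U) g(a.snd)⁻¹`. -/
theorem dartHolonomy_gaugeTransformZd (g : Site d → G) (U : LGConfig d G) (a : (zdGraph d).Dart) :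
    dartHolonomy (gaugeTransformZd g U) a = g a.fst * dartHolonomy U a * (g a.snd)⁻¹ := by
  rcases dartDir_spec a with h | h
  · have hs : dartStep a = ((a.fst, dartDir a), true) := by
      unfold dartStep; rw [if_pos h]
    simp only [dartHolonomy, hs, gaugeTransformZd, ← h, if_true]
  · have hne : ¬ a.snd = a.fst + Pi.single (dartDir a) 1 := fun h' => not_snd_eq_and_fst_eq _ _ _ h' h
    have hs : dartStep a = ((a.snd, dartDir a), false) := by
      unfold dartStep; rw [if_neg hne]
    simp only [dartHolonomy, hs, gaugeTransformZd, ← h, Bool.false_eq_true, if_false, mul_inv_rev, inv_inv,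
      mul_assoc]

/-- **Gauge covariance of walk holonomies on `ℤ^d`**: along a walk from `x` to `y`,
`hol_w(U^g) = g(x) hol_w(U) g(y)⁻¹` (Seiler LNP 159 Ch. 1). -/
theorem walkHolonomy_gaugeTransformZd (g : Site d → G) (U : LGConfig d G) :
    ∀ {x y : Site d} (w : (zdGraph d).Walk x y),
      walkHolonomy (gaugeTransformZd g U) w = g x * walkHolonomy U w * (g y)⁻¹
  | _, _, .nil => by simp
  | _, _, .cons h w => by
    rw [walkHolonomy_cons, walkHolonomy_cons, dartHolonomy_gaugeTransformZd, walkHolonomy_gaugeTransformZd g U w]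
    group

/-- **Wilson loop observables of class functions are gauge invariant on `ℤ^d`.** -/
theorem isZdGaugeInvariant_wilsonLoopObs {χ : G → ℝ} (hχ : ∀ g h, χ (g * h * g⁻¹) = χ h) {x : Site d}
    (w : (zdGraph d).Walk x x) : IsZdGaugeInvariant (wilsonLoopObs χ w) := fun g U => by
  simp only [wilsonLoopObs, walkHolonomy_gaugeTransformZd, hχ]

/-- The holonomy of the trivial configuration `U ≡ 1` is `1`. -/
theorem walkHolonomy_one : ∀ {x y : Site d} (w : (zdGraph d).Walk x y), walkHolonomy (1 : LGConfig d G) w = 1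
  | _, _, .nil => by simp
  | _, _, .cons h w => by
    rw [walkHolonomy_cons, walkHolonomy_one w, mul_one]
    simp [dartHolonomy]

end Gauge

/-! ### Dart multiplicities -/

section Mult

/-- The MULTIPLICITY of the link `e` in the walk `w`: the number of darts of `w` lying over `e` (in either
orientation). -/
def dartMult {x y : Site d} (w : (zdGraph d).Walk x y) (e : ZdEdge d) : ℕ :=
  @List.count (ZdEdge d) instBEqOfDecidableEq e (w.darts.map fun a => (dartStep a).1)

/-- A link carries a dart of `w` iff its multiplicity is positive. -/
theorem mem_walkEdges_iff_dartMult_pos {x y : Site d} (w : (zdGraph d).Walk x y) (e : ZdEdge d) :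
    e ∈ walkEdges w ↔ 0 < dartMult w e := by
  unfold walkEdges dartMult
  rw [List.mem_toFinset]
  exact (@List.count_pos_iff (ZdEdge d) instBEqOfDecidableEq _ e _).symm

/-- Off the walk the multiplicity vanishes. -/
theorem dartMult_eq_zero_of_not_mem {x y : Site d} (w : (zdGraph d).Walk x y) {e : ZdEdge d}
    (he : e ∉ walkEdges w) : dartMult w e = 0 := by
  by_contra h
  exact he ((mem_walkEdges_iff_dartMult_pos w e).2 (Nat.pos_of_ne_zero h))

/-- On the walk the multiplicity is at least one. -/
theorem one_le_dartMult_of_mem {x y : Site d} (w : (zdGraph d).Walk x y) {e : ZdEdge d}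
    (he : e ∈ walkEdges w) : 1 ≤ dartMult w e :=
  (mem_walkEdges_iff_dartMult_pos w e).1 he

/-- **The multiplicities add up to the length**: `∑_{e ∈ walkEdges w} mult_w(e) = |w|`. -/
theorem sum_walkEdges_dartMult {x y : Site d} (w : (zdGraph d).Walk x y) :
    ∑ e ∈ walkEdges w, dartMult w e = w.length := by
  unfold walkEdges dartMult
  rw [List.sum_toFinset_count_eq_length, List.length_map, Walk.length_darts]

/-- A list sum of a function vanishing off `y` is `count y` times its value at `y`. -/
theorem list_sum_map_eq_count_mul {α : Type*} [DecidableEq α] (L : List α) (f : α → ℝ) (y : α)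
    (h : ∀ z, z ≠ y → f z = 0) : (L.map f).sum = (L.count y : ℝ) * f y := by
  induction L with
  | nil => simp
  | cons a L ih =>
    rw [List.map_cons, List.sum_cons, ih, List.count_cons]
    by_cases hay : a = y
    · subst hay
      simp only [beq_self_eq_true, if_true]
      push_cast
      ring
    · have hb : (a == y) = false := beq_eq_false_iff_ne.2 hay
      rw [h a hay, hb]
      simp

end Mult

/-! ### `SU(N)`: one-link Frobenius bound of walk holonomies -/

section SUN

variable {N : ℕ}

/-- The Frobenius distance of dart holonomies is that of the underlying links (inversion is an isometry). -/
theorem suFrobDist_dartHolonomy (U V : LGConfig d (SUN N)) (a : (zdGraph d).Dart) :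
    suFrobDist (dartHolonomy U a) (dartHolonomy V a) = suFrobDist (U (dartStep a).1) (V (dartStep a).1) := by
  unfold dartHolonomy
  split_ifs
  · rfl
  · exact suFrobDist_inv _ _

/-- **Telescoping** for list products in `SU(N)`: `‖∏ f − ∏ g‖_F ≤ ∑ ‖f_k − g_k‖_F`. -/
theorem suFrobDist_prod_map_le {α : Type*} (l : List α) (f g : α → SUN N) :
    suFrobDist (l.map f).prod (l.map g).prod ≤ (l.map fun a => suFrobDist (f a) (g a)).sum := by
  induction l with
  | nil => simp [suFrobDist_self]
  | cons a l ih =>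
    simp only [List.map_cons, List.prod_cons, List.sum_cons]
    exact (suFrobDist_mul_le _ _ _ _).trans (add_le_add le_rfl ih)

/-- **Frobenius telescoping along a walk**: `‖hol_w U − hol_w V‖_F ≤ ∑_{darts a} ‖U_{e(a)} − V_{e(a)}‖_F`. -/
theorem suFrobDist_walkHolonomy_le {x y : Site d} (w : (zdGraph d).Walk x y) (U V : LGConfig d (SUN N)) :
    suFrobDist (walkHolonomy U w) (walkHolonomy V w) ≤
      (w.darts.map fun a => suFrobDist (U (dartStep a).1) (V (dartStep a).1)).sum := by
  unfold walkHolonomy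
  refine (suFrobDist_prod_map_le w.darts (dartHolonomy U) (dartHolonomy V)).trans (le_of_eq ?_)
  rw [List.map_congr_left fun a _ => suFrobDist_dartHolonomy U V a]

/-- **One-link form**: if `U = V` off `y` then `‖hol_w U − hol_w V‖_F ≤ mult_w(y) ‖U_y − V_y‖_F`. -/
theorem suFrobDist_walkHolonomy_le_dartMult {x y₀ : Site d} (w : (zdGraph d).Walk x y₀) {y : ZdEdge d}
    {U V : LGConfig d (SUN N)} (h : ∀ z, z ≠ y → U z = V z) :
    suFrobDist (walkHolonomy U w) (walkHolonomy V w) ≤ dartMult w y * suFrobDist (U y) (V y) := by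
  refine (suFrobDist_walkHolonomy_le w U V).trans (le_of_eq ?_)
  have hmap : (w.darts.map fun a => suFrobDist (U (dartStep a).1) (V (dartStep a).1)) =
      (w.darts.map fun a => (dartStep a).1).map fun e => suFrobDist (U e) (V e) := by
    rw [List.map_map]; rfl
  rw [hmap, list_sum_map_eq_count_mul _ _ y fun z hz => by rw [h z hz, suFrobDist_self]]
  rfl

/-- `|Re tr g / N| ≤ 1` in the form of the normalised character of the fundamental representation. -/
theorem abs_fundChar_le_one (g : SUN N) : |normalisedCharacter N (fundamentalRep (Fin N) g)| ≤ 1 := by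
  unfold normalisedCharacter
  rw [fundamentalRep_apply, inv_mul_eq_div]
  exact abs_re_trace_div_le_one g

/-- One-link bound of the normalised character of holonomies: if `U = V` off `y`,
`|χ_N(hol_w U) − χ_N(hol_w V)| ≤ mult_w(y)/√N · ‖U_y − V_y‖_F`. -/
theorem abs_fundChar_walkHolonomy_sub_le {x : Site d} (w : (zdGraph d).Walk x x) {y : ZdEdge d}
    {U V : LGConfig d (SUN N)} (h : ∀ z, z ≠ y → U z = V z) :
    |normalisedCharacter N (fundamentalRep (Fin N) (walkHolonomy U w)) -
        normalisedCharacter N (fundamentalRep (Fin N) (walkHolonomy V w))| ≤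
      dartMult w y / Real.sqrt N * suFrobDist (U y) (V y) := by
  rcases Nat.eq_zero_or_pos N with hN | hN
  · subst hN
    simp [normalisedCharacter]
  have hN0 : (0 : ℝ) < N := by exact_mod_cast hN
  have hs : 0 < Real.sqrt N := Real.sqrt_pos.2 hN0
  unfold normalisedCharacter
  rw [fundamentalRep_apply, fundamentalRep_apply, ← mul_sub, abs_mul, abs_inv, Nat.abs_cast]
  have key := (abs_re_trace_sub_le_suFrobDist (walkHolonomy U w) (walkHolonomy V w)).trans
    (mul_le_mul_of_nonneg_left (suFrobDist_walkHolonomy_le_dartMult w h) (Real.sqrt_nonneg _))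
  have h2 : (N : ℝ)⁻¹ * Real.sqrt N = 1 / Real.sqrt N := by
    rw [eq_div_iff hs.ne', mul_assoc, Real.mul_self_sqrt hN0.le, inv_mul_cancel₀ hN0.ne']
  calc (N : ℝ)⁻¹ * |((walkHolonomy U w : SUN N) : Matrix (Fin N) (Fin N) ℂ).trace.re -
          ((walkHolonomy V w : SUN N) : Matrix (Fin N) (Fin N) ℂ).trace.re|
      ≤ (N : ℝ)⁻¹ * (Real.sqrt N * (dartMult w y * suFrobDist (U y) (V y))) :=
        mul_le_mul_of_nonneg_left key (inv_nonneg.2 hN0.le)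
    _ = (N : ℝ)⁻¹ * Real.sqrt N * (dartMult w y * suFrobDist (U y) (V y)) := by ring
    _ = dartMult w y / Real.sqrt N * suFrobDist (U y) (V y) := by rw [h2]; ring

end SUN

/-! ### The loop term `c · Re tr U_γ / N` -/

section Term

variable {N : ℕ}

variable (N) in
/-- **The loop action term** of the closed walk `w` with coupling `c`: `c · χ_N(hol_w U) = c · Re tr(U_w) / N`
(tree `wilsonLoopObs` of the normalised fundamental character). -/
def loopTerm (c : ℝ) {x : Site d} (w : (zdGraph d).Walk x x) (U : LGConfig d (SUN N)) : ℝ :=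
  c * wilsonLoopObs (fun g : SUN N => normalisedCharacter N (fundamentalRep (Fin N) g)) w U

variable {c : ℝ} {x : Site d} (w : (zdGraph d).Walk x x)

/-- Unfolding lemma. -/
theorem loopTerm_apply (U : LGConfig d (SUN N)) :
    loopTerm N c w U = c * normalisedCharacter N (fundamentalRep (Fin N) (walkHolonomy U w)) := rfl

/-- `|loopTerm| ≤ |c|`. -/
theorem abs_loopTerm_le (U : LGConfig d (SUN N)) : |loopTerm N c w U| ≤ |c| := by
  rw [loopTerm_apply, abs_mul]
  exact mul_le_of_le_one_right (abs_nonneg c) (abs_fundChar_le_one _)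

/-- Continuity of the loop term. -/
theorem continuous_loopTerm : Continuous (loopTerm (d := d) N c w) :=
  continuous_const.mul (continuous_wilsonLoopObs (continuous_normalisedCharacter_comp (continuous_fundamentalRep (Fin N))) w)

/-- The loop term reads only the links under its darts. -/
theorem loopTerm_congr {U V : LGConfig d (SUN N)} (h : ∀ e ∈ walkEdges w, U e = V e) :
    loopTerm N c w U = loopTerm N c w V := by
  simp only [loopTerm_apply]
  rw [walkHolonomy_congr w fun a ha => h _ (by
    unfold walkEdges; rw [List.mem_toFinset, List.mem_map]; exact ⟨a, ha, rfl⟩)]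

/-- The loop term depends only on `walkEdges w`. -/
theorem dependsOn_loopTerm : DependsOn (loopTerm (d := d) N c w) (↑(walkEdges w) : Set (ZdEdge d)) :=
  fun _ _ hUV => loopTerm_congr w fun e he => hUV e (Finset.mem_coe.2 he)

/-- **One-link Lipschitz bound of the loop term**: if `U = V` off `y`,
`|loopTerm U − loopTerm V| ≤ |c| mult_w(y)/√N · ‖U_y − V_y‖_F`. -/
theorem abs_loopTerm_sub_le {y : ZdEdge d} {U V : LGConfig d (SUN N)} (h : ∀ z, z ≠ y → U z = V z) :
    |loopTerm N c w U - loopTerm N c w V| ≤ |c| * (dartMult w y / Real.sqrt N) * suFrobDist (U y) (V y) := by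
  rw [loopTerm_apply, loopTerm_apply, ← mul_sub, abs_mul, mul_assoc]
  exact mul_le_mul_of_nonneg_left (abs_fundChar_walkHolonomy_sub_le w h) (abs_nonneg c)

/-- **Oscillation witness**: the loop term oscillates by at most `2|c|` in every link. -/
theorem isOscBound_loopTerm : Dobrushin.IsOscBound (loopTerm (d := d) N c w) fun _ => 2 * |c| :=
  Dobrushin.IsOscBound.of_abs_le (abs_nonneg c) (abs_loopTerm_le w)

/-- **Lipschitz witness**: the loop term is `|c| mult_w(y)/√N`-Lipschitz (Frobenius) in the link `y`. -/
theorem isLipBound_loopTerm :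
    IsLipBound suFrobDist (loopTerm (d := d) N c w) fun y => |c| * (dartMult w y / Real.sqrt N) :=
  ⟨fun y => by positivity, fun _ _ _ h => abs_loopTerm_sub_le w h⟩

/-- **The loop term is gauge invariant** (cyclicity of the trace). -/
theorem isZdGaugeInvariant_loopTerm : IsZdGaugeInvariant (loopTerm (d := d) N c w) := fun g U => by
  simp only [loopTerm]
  rw [isZdGaugeInvariant_wilsonLoopObs (fun a b => ?_) w g U]
  unfold normalisedCharacter
  rw [map_mul, map_mul, Matrix.trace_mul_cycle, ← map_mul, inv_mul_cancel, map_one, one_mul]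

/-- At the trivial configuration the loop term equals its coupling (`N ≥ 1`). -/
theorem loopTerm_one (hN : 1 ≤ N) : loopTerm N c w (1 : LGConfig d (SUN N)) = c := by
  haveI : NeZero N := ⟨by omega⟩
  rw [loopTerm_apply, walkHolonomy_one, map_one, normalisedCharacter_one, mul_one]

end Term

end Summit.Ventures.YMGap.RobustBall

end
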